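import Summits.Ventures.HSemireg.WedgeHankelRecurrenceGaussChebyshevUComposition

/-!
# Venture HSemireg — **A COMMON NONCONSTANT FACTOR KILLS THE RESULTANT IN EVERY FORMAL DEGREE** (domain coefficients): `h ∣ f`, `h ∣ g`, `deg h ≥ 1`, `f, g ≠ 0`, `deg f ≤ m`, `deg g ≤ n`
# `⇒ Res_{(m,n)}(f, g) = 0`; hence over `ℤ` (no rational root needed) **`Res(U_{2n+1}, T_{n+1}) = 0`** (`U_{2n+1} = 2T_{n+1}U_n`, N438) and **`Res(U_{(k+1)(n+2)−1}, U_{n+1}) = 0`** (nesting, N438)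

HONEST FRAMING. Part of the Lean index of the computation cell `pub-hsemireg` (seat p10 gen 47, Sunday typer «UNIFORM-IN-n»).  Polynomial algebra only (Mathlib `Polynomial.resultant`,
`Polynomial.Chebyshev`); no variety, no cohomology theory, no sheaf, no Ext group and no semiregularity map is constructed here; nothing here says that HC / HC_CM / HC_AV holds; no Literature
fact (unproved `Prop`) is declared or used.  Custodian versions as in `WedgeHankelSiegelIdeal` (1/3).
SOURCES (cited).  I. M. Gelfand, M. M. Kapranov, A. V. Zelevinsky, *Discriminants, Resultants, and Multidimensional Determinants* (1994), Ch. 12 §1 (the resultant vanishes iff a common factor of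
positive degree exists — the easy direction typed here for arbitrary formal degrees); J. C. Mason, D. C. Handscomb, *Chebyshev Polynomials* (2003), §1.2.2.  The Chebyshev instances are
COROLLARIES typed here of N438.
PROOF TYPED HERE.  Formal-degree padding (`resultant_add_left_deg`, `resultant_add_right_deg`), `resultant_mul_left`, `resultant_mul_right`, Mathlib `resultant_self_eq_zero`; N438
`chebyshevU_two_mul_add_one`, `chebyshevU_dvd_U_mul_pred`; Mathlib `natDegree_T`, `natDegree_U_natCast`, `T_ne_zero`, `U_ne_zero`.
DEDUP DISCLOSURE (`rg -n -i 'common_factor|resultant_eq_zero_of_dvd' Summits/Ventures/HSemireg`, 2026-09-04): N434 `resultant_eq_zero_of_common_root` (needs a root in `R`); 0 hits for the 3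
names below.

WHAT IS IN THE TREE.  N434 `resultant_eq_zero_of_common_root`; N438 `chebyshevU_two_mul_add_one`, `chebyshevU_dvd_U_mul_pred`; Mathlib resultant algebra as listed.
THIS FILE (namespace `Summit.Ventures.HSemireg.Wedge.HankelOuter` continued; CHAINED on N438; 0 definitions):
* §1204 **`resultant_eq_zero_of_common_factor`**, `chebyshevUT_resultant_two_mul_add_one` (`Res_{(2n+1,n+1)}(U_{2n+1}, T_{n+1}) = 0`), `chebyshevU_resultant_nested`
  (`Res_{(k(n+2)+n+1, n+1)}(U_{k(n+2)+n+1}, U_{n+1}) = 0`).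
CAVEATS.  Domain coefficients and `f, g ≠ 0` (the degenerate `Res_{(0,0)}(0,0) = 1` is excluded).  Nothing Ext-side.  New names only.
-/

open Module Polynomial
open scoped Matrix Polynomial

namespace Summit.Ventures.HSemireg.Wedge.HankelOuter

/-! ## §1204. Common factors and the resultant -/

/-- **A common factor of positive degree annihilates the resultant in every admissible formal degree** (domain; `f, g ≠ 0`). [GKZ Ch. 12 §1; this file, §1204] -/
theorem resultant_eq_zero_of_common_factor {R : Type*} [CommRing R] [IsDomain R] {f g h : R[X]} (hf : h ∣ f) (hg : h ∣ g) (hh : h.natDegree ≠ 0) (hf0 : f ≠ 0) (hg0 : g ≠ 0)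
    {m n : ℕ} (hm : f.natDegree ≤ m) (hn : g.natDegree ≤ n) : f.resultant g m n = 0 := by
  obtain ⟨f₁, rfl⟩ := hf
  obtain ⟨g₁, rfl⟩ := hg
  have hh0 : h ≠ 0 := left_ne_zero_of_mul hf0
  have hf₁ : f₁ ≠ 0 := right_ne_zero_of_mul hf0
  have hg₁ : g₁ ≠ 0 := right_ne_zero_of_mul hg0
  obtain ⟨i, hi⟩ := Nat.exists_eq_add_of_le hm
  obtain ⟨j, hj⟩ := Nat.exists_eq_add_of_le hn
  rw [hi, hj, resultant_add_left_deg _ _ _ _ _ le_rfl, resultant_add_right_deg _ _ _ _ _ le_rfl]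
  suffices hz : (h * f₁).resultant (h * g₁) (h * f₁).natDegree (h * g₁).natDegree = 0 by rw [hz, mul_zero, mul_zero]
  rw [natDegree_mul hh0 hf₁, resultant_mul_left h f₁ (h * g₁) _ le_rfl, natDegree_mul hh0 hg₁, resultant_mul_right h h g₁ _ le_rfl, resultant_self_eq_zero h hh, zero_mul,
    zero_mul]

/-- **`Res_{(2n+1, n+1)}(U_{2n+1}, T_{n+1}) = 0`** over `ℤ` (`T_{n+1} ∣ U_{2n+1}`, N438). [corollary; Mason–Handscomb §1.2.2; this file, §1204] -/
theorem chebyshevUT_resultant_two_mul_add_one (n : ℕ) :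
    (Polynomial.Chebyshev.U ℤ (2 * (n : ℤ) + 1)).resultant (Polynomial.Chebyshev.T ℤ ((n : ℤ) + 1)) (2 * n + 1) (n + 1) = 0 := by
  have hdvd : Polynomial.Chebyshev.T ℤ ((n : ℤ) + 1) ∣ Polynomial.Chebyshev.U ℤ (2 * (n : ℤ) + 1) :=
    ⟨2 * Polynomial.Chebyshev.U ℤ (n : ℤ), by rw [chebyshevU_two_mul_add_one]; ring⟩
  have hdT : (Polynomial.Chebyshev.T ℤ ((n : ℤ) + 1)).natDegree = n + 1 := by rw [Polynomial.Chebyshev.natDegree_T]; omega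
  have hdU : (Polynomial.Chebyshev.U ℤ (2 * (n : ℤ) + 1)).natDegree = 2 * n + 1 := by
    rw [show (2 * (n : ℤ) + 1) = ((2 * n + 1 : ℕ) : ℤ) by push_cast; ring, Polynomial.Chebyshev.natDegree_U_natCast]
  exact resultant_eq_zero_of_common_factor hdvd (dvd_refl _) (by rw [hdT]; omega) (Polynomial.Chebyshev.U_ne_zero ℤ _ (by omega)) (Polynomial.Chebyshev.T_ne_zero ℤ _) hdU.le hdT.le

/-- **NESTED RULES: `Res_{(k(n+2)+n+1, n+1)}(U_{k(n+2)+n+1}, U_{n+1}) = 0`** over `ℤ` (`U_{n+1} ∣ U_{(k+1)(n+2)−1}`, N438). [corollary; Mason–Handscomb §1.2.2, Ch. 8; this file, §1204] -/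
theorem chebyshevU_resultant_nested (k n : ℕ) :
    (Polynomial.Chebyshev.U ℤ ((k : ℤ) * ((n : ℤ) + 2) + (n : ℤ) + 1)).resultant (Polynomial.Chebyshev.U ℤ ((n : ℤ) + 1)) (k * (n + 2) + n + 1) (n + 1) = 0 := by
  have hdvd : Polynomial.Chebyshev.U ℤ ((n : ℤ) + 1) ∣ Polynomial.Chebyshev.U ℤ ((k : ℤ) * ((n : ℤ) + 2) + (n : ℤ) + 1) := by
    have h := chebyshevU_dvd_U_mul_pred (R := ℤ) (k + 1) ((n : ℤ) + 1)
    rwa [show (((k + 1 : ℕ)) : ℤ) * ((n : ℤ) + 1 + 1) - 1 = (k : ℤ) * ((n : ℤ) + 2) + (n : ℤ) + 1 by push_cast; ring] at h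
  have hd1 : (Polynomial.Chebyshev.U ℤ ((n : ℤ) + 1)).natDegree = n + 1 := by
    rw [show ((n : ℤ) + 1) = ((n + 1 : ℕ) : ℤ) by push_cast; ring, Polynomial.Chebyshev.natDegree_U_natCast]
  have hd2 : (Polynomial.Chebyshev.U ℤ ((k : ℤ) * ((n : ℤ) + 2) + (n : ℤ) + 1)).natDegree = k * (n + 2) + n + 1 := by
    rw [show ((k : ℤ) * ((n : ℤ) + 2) + (n : ℤ) + 1) = ((k * (n + 2) + n + 1 : ℕ) : ℤ) by push_cast; ring, Polynomial.Chebyshev.natDegree_U_natCast]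
  have h0 : (0 : ℤ) ≤ (k : ℤ) * ((n : ℤ) + 2) + (n : ℤ) := by positivity
  exact resultant_eq_zero_of_common_factor hdvd (dvd_refl _) (by rw [hd1]; omega) (Polynomial.Chebyshev.U_ne_zero ℤ _ fun h => by linarith [h0])
    (Polynomial.Chebyshev.U_ne_zero ℤ _ (by omega)) hd2.le hd1.le

end Summit.Ventures.HSemireg.Wedge.HankelOuter
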